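import Literature.Probability.Percolation.FivePointHolomorphy
import Mathlib.Algebra.Field.ZMod
import Mathlib.LinearAlgebra.Matrix.Rank
import Mathlib.FieldTheory.Finiteness
import HarnessLib

/-!
# Loop configurations on a `k`-marked discrete domain, I: the edge space of `H_G`, the `2 ^ #G` count, corner faces, components

Topic `Literature/Probability/Percolation`; lane pcv-sawmu (CriticalPhenomena). GENERIC-`k` edition of the loop-space layer of the
five-marked files (`FiveMarkedLoopStubs/Space.lean`, `FivePointNormalisation.lean`, there `k = 5`): for EVERY `D : TriMarkedDomain k`
(Bollobás–Riordan 2006 Ch. 7 §7.2.2) — the edge set `hBonds D` of the hexagonal graph `H_G` (bonds of `𝕋` with an endpoint in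
`G = D.verts`), the Euler bookkeeping `#hBonds + 1 = #(faces touching G) + #G`, the `𝔽₂` incidence matrix and its rank, and
Khristoforov–Smirnov's count «there are exactly `2^{#Faces(Ω)}` loop configurations with given disorders» (arXiv:2111.15612 §1.2,
p. 2): for every EVEN set `O` of faces touching `G`, exactly `2 ^ #G` edge sets `ξ ⊆ hBonds D` have odd side count exactly on `O`
(`card_filter_parity_eq`); then the CORNER FACES `y_i` of the marks (Khristoforov–Smirnov's boundary disorders `u_i`, up to the
terminal half-edge; `predDart`, `IsCornerFace`, `yc`, `corners`, type II) and the components of the side graph of an edge set of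
side count `≤ 2` (`odd_component`, `restrict_off_component`). The proofs are those of the `k = 5` files verbatim (they use `D.verts`,
`D.connected`, `D.euler` and the mark fields only); the `D`-free notions (`side`, `xiDeg`, `XiLinked`, `sideGraph`, …) are the tree's.

## References
* M. Khristoforov, S. Smirnov, *Percolation and O(1) loop model*, arXiv:2111.15612 (2021), §1.2 (loop configurations, pp. 2–3).
* B. Bollobás, O. Riordan, *Percolation*, Cambridge University Press (2006), Ch. 7 §7.2.2 pp. 168–171.
-/

open Finset

namespace Literature.Probability.Percolation.MarkedLoops

open Literature.Probability.Percolation Literature.Probability.LatticeModels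
open Literature.Probability.Percolation.FivePoint (Inc inc_mk_iff side inc_side side_injective xiDeg XiLinked oppFace_injective' tau ccwNbr
  hexFaceVertices_eq_triple)
open Literature.Probability.Percolation.FivePoint.N5 (sideGraph side_oppFace_oppIdx xiLinked_iff_reachable xorDeg_holds l1_xiDeg_eq
  l1_odd_xiDeg_singleton_iff h1_ne_oppFace h1_union_sides_eq_symmDiff coreCompl coreEnd coreOf oddSetOf ha_coreEnd_eq_or
  ht2_sideGraph_mono ht2_union_eq_symmDiff ht2_xiDeg_image_v ht2_not_iff_of_not ht3zk ht3Lk ht3_zk_subset ht3_mem_zk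
  ht3_pair_eq_side ha_ccwNbr_eq_oppFace xiDeg_erase_side xiDeg_erase_of_forall_ne)
open TriMarkedDomain

variable {nm : ℕ} (D : TriMarkedDomain nm)

/-- Auxiliary. [folklore] -/
private theorem fin3_cases₄ (v j : Fin 3) : j = v ∨ j = v + 1 ∨ j = v + 2 := by
  revert v j; decide

open Classical in
/-- The edge set of `H_G` recorded by dual bonds: bonds `{u, v}` of `𝕋` with at least one endpoint in `G`
(interior bonds and boundary darts). [cite: KhristoforovSmirnov2021, §1.2, proof of Lemma 2 (the colouring ↔ loop-configuration bijection), p. 3] -/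
noncomputable def hBonds : Finset (Sym2 (Site 2)) :=
  (((D.verts ∪ triOuterBdry D.verts) ×ˢ (D.verts ∪ triOuterBdry D.verts)).filter
      fun p => triGraph.Adj p.1 p.2 ∧ (p.1 ∈ D.verts ∨ p.2 ∈ D.verts)).image fun p => s(p.1, p.2)

/-- a bond with an endpoint in `G` is an edge of `H_G`. [cite: KhristoforovSmirnov2021, §1.2 (loop configurations, pp. 2–3)] -/
theorem mem_hBonds {u v : Site 2} (hadj : triGraph.Adj u v) (hG : u ∈ D.verts ∨ v ∈ D.verts) :
    s(u, v) ∈ hBonds D := by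
  classical
  have key : ∀ a b : Site 2, triGraph.Adj a b → (a ∈ D.verts ∨ b ∈ D.verts) → a ∈ D.verts ∪ triOuterBdry D.verts := by
    intro a b hab h
    by_cases ha : a ∈ D.verts
    · exact Finset.mem_union_left _ ha
    · have hb : b ∈ D.verts := h.resolve_left ha
      exact Finset.mem_union_right _ (Finset.mem_image.2 ⟨(b, a), mem_triBdryDarts.2 ⟨hb, ha, hab.symm⟩, rfl⟩)
  unfold hBonds
  refine Finset.mem_image.2 ⟨(u, v), Finset.mem_filter.2 ⟨Finset.mem_product.2 ⟨key u v hadj hG, key v u hadj.symm hG.symm⟩, hadj, hG⟩, rfl⟩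



/-! #### Euler bookkeeping: `#hBonds + 1 = #(faces touching G) + #G` -/

/-- twice the number of `H_G`-bonds = ordered adjacent pairs inside `G` + twice the boundary darts. [cite: KhristoforovSmirnov2021, §1.2 (loop configurations, pp. 2–3)] -/
theorem card_hBonds_two_mul :
    2 * #(hBonds D) = #(triAdjPairs D.verts) + 2 * #(triBdryDarts D.verts) := by
  classical
  set P := ((D.verts ∪ triOuterBdry D.verts) ×ˢ (D.verts ∪ triOuterBdry D.verts)).filter
      fun p : Site 2 × Site 2 => triGraph.Adj p.1 p.2 ∧ (p.1 ∈ D.verts ∨ p.2 ∈ D.verts) with hP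
  have hmemP : ∀ p : Site 2 × Site 2, p ∈ P ↔ triGraph.Adj p.1 p.2 ∧ (p.1 ∈ D.verts ∨ p.2 ∈ D.verts) := by
    intro p
    rw [hP, Finset.mem_filter, Finset.mem_product]
    constructor
    · exact fun h => h.2
    · rintro ⟨hadj, hG⟩
      have key : ∀ a b : Site 2, triGraph.Adj a b → (a ∈ D.verts ∨ b ∈ D.verts) → a ∈ D.verts ∪ triOuterBdry D.verts := by
        intro a b hab h
        by_cases ha : a ∈ D.verts
        · exact Finset.mem_union_left _ ha
        · exact Finset.mem_union_right _ (Finset.mem_image.2 ⟨(b, a), mem_triBdryDarts.2 ⟨h.resolve_left ha, ha, hab.symm⟩, rfl⟩)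
      exact ⟨⟨key _ _ hadj hG, key _ _ hadj.symm hG.symm⟩, hadj, hG⟩
  have hPdef : hBonds D = P.image fun p => s(p.1, p.2) := rfl
  -- each bond has exactly the two preimages (u, v), (v, u)
  have hfib : ∀ b ∈ hBonds D, #(P.filter fun p => s(p.1, p.2) = b) = 2 := by
    intro b hb
    rw [hPdef] at hb
    obtain ⟨p, hp, rfl⟩ := Finset.mem_image.1 hb
    have hp' := (hmemP p).1 hp
    have hne : p.1 ≠ p.2 := hp'.1.ne
    have : P.filter (fun q => s(q.1, q.2) = s(p.1, p.2)) = {p, (p.2, p.1)} := by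
      ext q
      rw [Finset.mem_filter, Finset.mem_insert, Finset.mem_singleton, hmemP]
      constructor
      · rintro ⟨-, he⟩
        rcases Sym2.eq_iff.1 he with ⟨h1, h2⟩ | ⟨h1, h2⟩
        · exact Or.inl (Prod.ext h1 h2)
        · exact Or.inr (Prod.ext h1 h2)
      · rintro (rfl | rfl)
        · exact ⟨hp', rfl⟩
        · exact ⟨⟨hp'.1.symm, hp'.2.symm⟩, Sym2.eq_swap⟩
    rw [this]
    exact Finset.card_pair fun he => hne (congrArg Prod.fst he)
  have hcardP : #P = 2 * #(hBonds D) := by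
    have := Finset.card_eq_sum_card_fiberwise (f := fun p : Site 2 × Site 2 => s(p.1, p.2)) (s := P) (t := hBonds D)
      (fun p hp => by rw [hPdef]; exact Finset.mem_image_of_mem _ hp)
    rw [this, Finset.sum_congr rfl hfib, Finset.sum_const, smul_eq_mul, mul_comm]
  have hsplit : #P = #(triAdjPairs D.verts) + 2 * #(triBdryDarts D.verts) := by
    have hdisj : P = triAdjPairs D.verts ∪ (triBdryDarts D.verts ∪ (triBdryDarts D.verts).image Prod.swap) := by
      ext p
      rw [hmemP, Finset.mem_union, Finset.mem_union, mem_triAdjPairs, mem_triBdryDarts, Finset.mem_image]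
      constructor
      · rintro ⟨hadj, hG⟩
        by_cases h1 : p.1 ∈ D.verts
        · by_cases h2 : p.2 ∈ D.verts
          · exact Or.inl ⟨h1, h2, hadj⟩
          · exact Or.inr (Or.inl ⟨h1, h2, hadj⟩)
        · have h2 : p.2 ∈ D.verts := hG.resolve_left h1
          exact Or.inr (Or.inr ⟨(p.2, p.1), mem_triBdryDarts.2 ⟨h2, h1, hadj.symm⟩, rfl⟩)
      · rintro (⟨h1, -, hadj⟩ | ⟨h1, -, hadj⟩ | ⟨q, hq, rfl⟩)
        · exact ⟨hadj, Or.inl h1⟩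
        · exact ⟨hadj, Or.inl h1⟩
        · obtain ⟨hq1, -, hq⟩ := mem_triBdryDarts.1 hq
          exact ⟨hq.symm, Or.inr hq1⟩
    rw [hdisj, Finset.card_union_of_disjoint, Finset.card_union_of_disjoint,
      Finset.card_image_of_injective _ Prod.swap_injective]
    · ring
    · rw [Finset.disjoint_left]
      intro p hp hp'
      obtain ⟨q, hq, rfl⟩ := Finset.mem_image.1 hp'
      exact (mem_triBdryDarts.1 hq).2.1 (mem_triBdryDarts.1 hp).1
    · rw [Finset.disjoint_left]
      intro p hp hp'
      rcases Finset.mem_union.1 hp' with h | h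
      · exact (mem_triBdryDarts.1 h).2.1 (mem_triAdjPairs.1 hp).2.1
      · obtain ⟨q, hq, rfl⟩ := Finset.mem_image.1 h
        exact (mem_triBdryDarts.1 hq).2.1 (mem_triAdjPairs.1 hp).1
  omega


/-- the faces touching `G` are the faces inside `G` plus the boundary faces (one per boundary dart). [cite: KhristoforovSmirnov2021, §1.2 (loop configurations, pp. 2–3)] -/
private theorem card_triFacesIn_add_card_triBdryDarts :
    #(triFacesIn D.verts) + #(triBdryDarts D.verts) = #(triFacesTouching D.verts) := by
  classical
  have hT1 := card_filter_turnDeg_eq D.verts (c := 1) (Or.inl rfl)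
  have hT2 := card_filter_turnDeg_eq D.verts (c := 2) (Or.inr rfl)
  have hL : #(triBdryDarts D.verts) = #((triBdryDarts D.verts).filter fun d => turnDeg D.verts d = 1) +
      #((triBdryDarts D.verts).filter fun d => turnDeg D.verts d = 2) := by
    rw [Finset.card_filter, Finset.card_filter, ← Finset.sum_add_distrib, Finset.card_eq_sum_ones]
    refine Finset.sum_congr rfl fun d _ => ?_
    unfold turnDeg
    split_ifs <;> simp_all
  have hF : #(triFacesIn D.verts) = #((triFacesTouching D.verts).filter fun w => faceDeg D.verts w = 3) := by
    rw [card_triFacesIn_eq_sum, Finset.card_filter]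
  rw [hL, hT1, hT2, hF, Finset.card_filter, Finset.card_filter, Finset.card_filter, ← Finset.sum_add_distrib,
    ← Finset.sum_add_distrib, Finset.card_eq_sum_ones]
  refine Finset.sum_congr rfl fun w hw => ?_
  have hle := faceDeg_le D.verts w
  have hge := one_le_faceDeg hw
  interval_cases (faceDeg D.verts w) <;> simp

/-- **Euler bookkeeping for `H_G`**: `#E(H_G) + 1 = #V(H_G) + #G` (the union of hexagons is a disc: `D.euler`). [cite: KhristoforovSmirnov2021, §1.2 (loop configurations, pp. 2–3)] -/
theorem card_hBonds_add_one : #(hBonds D) + 1 = #(triFacesTouching D.verts) + #D.verts := by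
  have h2 := card_hBonds_two_mul D
  have hE := D.euler
  unfold triEulerTwice at hE
  have hT := card_triFacesIn_add_card_triBdryDarts D
  omega


/-! #### Incidence in `H_G`: bonds and their two bordering faces, faces and their three sides -/

/-- an `H_G`-bond incident to a face is one of its sides. [cite: KhristoforovSmirnov2021, §1.2 (loop configurations, pp. 2–3)] -/
theorem exists_side_eq_of_inc {F : HexVertex} {b : Sym2 (Site 2)} (hb : b ∈ hBonds D) (h : Inc F b) :
    ∃ j : Fin 3, b = side F j := by
  classical
  obtain ⟨p, hp, rfl⟩ := Finset.mem_image.1 hb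
  have hadj : triGraph.Adj p.1 p.2 := (Finset.mem_filter.1 hp).2.1
  obtain ⟨h1, h2⟩ := inc_mk_iff.1 h
  obtain ⟨a, ha⟩ := mem_hexFaceVertices_iff_faceVertex.1 h1
  obtain ⟨c, hc⟩ := mem_hexFaceVertices_iff_faceVertex.1 h2
  have hac : c ≠ a := fun e => hadj.ne (by rw [ha, hc, e])
  have e3 : a + 2 + 1 = a := by rw [add_assoc]; exact add_eq_left.2 (by decide)
  have e4 : a + 2 + 2 = a + 1 := by rw [add_assoc]; congr 1
  have e5 : a + 1 + 1 = a + 2 := by rw [add_assoc]; rfl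
  have e6 : a + 1 + 2 = a := by rw [add_assoc]; exact add_eq_left.2 (by decide)
  unfold side
  rcases fin3_cases₄ a c with e | e | e
  · exact absurd e hac
  · refine ⟨a + 2, ?_⟩
    rw [e3, e4, ← e, ← ha, ← hc]
  · refine ⟨a + 1, ?_⟩
    rw [e5, e6, ← e, ← ha, ← hc, Sym2.eq_swap]

open Classical in
/-- the faces touching `G` incident to an `H_G`-bond are its two bordering faces. [cite: KhristoforovSmirnov2021, §1.2 (loop configurations, pp. 2–3)] -/
theorem filter_inc_eq_pair {u v : Site 2} (hu : u ∈ D.verts) (hadj : triGraph.Adj u v) :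
    (triFacesTouching D.verts).filter (fun F => Inc F s(u, v)) = {leftFace u v, leftFace v u} := by
  classical
  rw [← filter_mem_mem_eq_pair hu hadj]
  exact Finset.filter_congr fun F _ => inc_mk_iff

/-- every `H_G`-bond is `s(u, v)` with `u ∈ G` and `u ∼ v`. [cite: KhristoforovSmirnov2021, §1.2 (loop configurations, pp. 2–3)] -/
theorem exists_rep_of_mem_hBonds {b : Sym2 (Site 2)} (hb : b ∈ hBonds D) :
    ∃ u v : Site 2, b = s(u, v) ∧ u ∈ D.verts ∧ triGraph.Adj u v := by
  classical
  obtain ⟨p, hp, rfl⟩ := Finset.mem_image.1 hb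
  obtain ⟨-, hadj, hG⟩ := Finset.mem_filter.1 hp
  rcases hG with h | h
  · exact ⟨p.1, p.2, rfl, h, hadj⟩
  · exact ⟨p.2, p.1, Sym2.eq_swap, h, hadj.symm⟩

/-! #### The incidence matrix over `𝔽₂`; indicators; the boundary of an indicator is the side count -/

open Classical in
/-- the incidence matrix of `H_G` over `𝔽₂`: rows = faces touching `G`, columns = `H_G`-bonds. [folklore] [cite: KhristoforovSmirnov2021, §1.2 (loop configurations, pp. 2–3)] -/
noncomputable def incMat : Matrix ↥(triFacesTouching D.verts) ↥(hBonds D) (ZMod 2) :=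
  fun F b => if Inc F.1 b.1 then 1 else 0

open Classical in
/-- the indicator vector of an edge set on the `H_G`-bonds. [folklore] [cite: KhristoforovSmirnov2021, §1.2 (loop configurations, pp. 2–3)] -/
noncomputable def indic (ξ : Finset (Sym2 (Site 2))) : ↥(hBonds D) → ZMod 2 := fun b => if b.1 ∈ ξ then 1 else 0

/-- **the boundary of an indicator counts sides**: `(M · 𝟙_ξ)(F) = xiDeg ξ F (mod 2)` for `ξ ⊆ hBonds`. [cite: KhristoforovSmirnov2021, §1.2 (loop configurations, pp. 2–3)] -/
theorem incMat_mulVec_indic {ξ : Finset (Sym2 (Site 2))} (hξ : ξ ⊆ hBonds D) (F : ↥(triFacesTouching D.verts)) :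
    (incMat D).mulVec (indic D ξ) F = (xiDeg ξ F.1 : ZMod 2) := by
  classical
  have hterm : ∀ b : ↥(hBonds D), incMat D F b * indic D ξ b = if (Inc F.1 b.1 ∧ b.1 ∈ ξ) then (1 : ZMod 2) else 0 := by
    intro b
    unfold incMat indic
    by_cases h1 : Inc F.1 b.1 <;> by_cases h2 : b.1 ∈ ξ <;> simp [h1, h2]
  have hsum : (incMat D).mulVec (indic D ξ) F = ∑ b, incMat D F b * indic D ξ b := rfl
  rw [hsum, Finset.sum_congr rfl (fun b _ => hterm b), Finset.sum_boole]
  unfold xiDeg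
  congr 1
  -- bijection `j ↦ side F j` between `{j | side j ∈ ξ}` and `{b ∈ hBonds | Inc F b ∧ b ∈ ξ}`
  symm
  refine Finset.card_bij (fun j hj => (⟨side F.1 j, hξ (Finset.mem_filter.1 hj).2⟩ : ↥(hBonds D)))
    (fun j hj => ?_) (fun j₁ _ j₂ _ h => side_injective F.1 (congrArg Subtype.val h)) (fun b hb => ?_)
  · exact Finset.mem_filter.2 ⟨Finset.mem_univ _, inc_side F.1 j, (Finset.mem_filter.1 hj).2⟩
  · obtain ⟨-, hinc, hmem⟩ := Finset.mem_filter.1 hb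
    obtain ⟨j, hj⟩ := exists_side_eq_of_inc D b.2 hinc
    refine ⟨j, Finset.mem_filter.2 ⟨Finset.mem_univ _, ?_⟩, Subtype.ext hj.symm⟩
    show side F.1 j ∈ ξ
    rw [← hj]; exact hmem


/-! #### The coboundary `Mᵀ` has the constants as kernel (`H_G` is connected) -/

/-- the left face of a bond with tail in `G` touches `G`. [cite: KhristoforovSmirnov2021, §1.2 (loop configurations, pp. 2–3)] -/
private theorem leftFace_mem_touching {u v : Site 2} (hu : u ∈ D.verts) (hadj : triGraph.Adj u v) :
    leftFace u v ∈ triFacesTouching D.verts :=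
  mem_triFacesTouching.2 ⟨u, hu, by rw [hexFaceVertices_leftFace hadj]; simp⟩

/-- the right face of a bond with tail in `G` touches `G`. [cite: KhristoforovSmirnov2021, §1.2 (loop configurations, pp. 2–3)] -/
private theorem leftFace_symm_mem_touching {u v : Site 2} (hu : u ∈ D.verts) (hadj : triGraph.Adj u v) :
    leftFace v u ∈ triFacesTouching D.verts :=
  mem_triFacesTouching.2 ⟨u, hu, by rw [hexFaceVertices_leftFace hadj.symm]; simp⟩

/-- the value of a face function extended by `0` off the faces touching `G`. [folklore] [cite: KhristoforovSmirnov2021, §1.2 (loop configurations, pp. 2–3)] -/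
noncomputable def fval (f : ↥(triFacesTouching D.verts) → ZMod 2) (F : HexVertex) : ZMod 2 := by
  classical
  exact if h : F ∈ triFacesTouching D.verts then f ⟨F, h⟩ else 0

/-- Auxiliary. [cite: KhristoforovSmirnov2021, §1.2 (loop configurations, pp. 2–3)] -/
theorem fval_of_mem (f : ↥(triFacesTouching D.verts) → ZMod 2) {F : HexVertex} (h : F ∈ triFacesTouching D.verts) :
    fval D f F = f ⟨F, h⟩ := by
  unfold fval; rw [dif_pos h]

/-- **the coboundary at a bond**: `(Mᵀ f)(uv) = f(left face) + f(right face)`. [cite: KhristoforovSmirnov2021, §1.2 (loop configurations, pp. 2–3)] -/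
theorem incMat_transpose_mulVec_apply (f : ↥(triFacesTouching D.verts) → ZMod 2) {u v : Site 2} (hu : u ∈ D.verts)
    (hadj : triGraph.Adj u v) (hb : s(u, v) ∈ hBonds D) :
    (incMat D).transpose.mulVec f ⟨s(u, v), hb⟩ = fval D f (leftFace u v) + fval D f (leftFace v u) := by
  classical
  have hsum : (incMat D).transpose.mulVec f ⟨s(u, v), hb⟩ = ∑ F, (if Inc F.1 s(u, v) then (1 : ZMod 2) else 0) * f F := rfl
  rw [hsum]
  simp only [boole_mul]
  rw [← Finset.sum_filter]
  have hpair : (Finset.univ.filter fun F : ↥(triFacesTouching D.verts) => Inc F.1 s(u, v)) =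
      {⟨leftFace u v, leftFace_mem_touching D hu hadj⟩, ⟨leftFace v u, leftFace_symm_mem_touching D hu hadj⟩} := by
    ext F
    rw [Finset.mem_filter, Finset.mem_insert, Finset.mem_singleton]
    have key : Inc F.1 s(u, v) ↔ F.1 = leftFace u v ∨ F.1 = leftFace v u := by
      have := Finset.ext_iff.1 (filter_inc_eq_pair D hu hadj) F.1
      rw [Finset.mem_filter, Finset.mem_insert, Finset.mem_singleton] at this
      exact ⟨fun h => this.1 ⟨F.2, h⟩, fun h => (this.2 h).2⟩
    simp only [Finset.mem_univ, true_and, key, Subtype.ext_iff]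
  rw [hpair, Finset.sum_pair, fval_of_mem, fval_of_mem]
  intro he
  exact leftFace_ne_leftFace_symm hadj (congrArg Subtype.val he)

/-- in `ZMod 2`, `a + b = 0 ↔ a = b`. [folklore] -/
private theorem zmod2_add_eq_zero_iff (a b : ZMod 2) : a + b = 0 ↔ a = b := by
  revert a b; decide

/-- a function in the kernel of the coboundary takes equal values on the two faces of every `H_G`-bond. [cite: KhristoforovSmirnov2021, §1.2 (loop configurations, pp. 2–3)] -/
theorem fval_leftFace_eq_of_ker {f : ↥(triFacesTouching D.verts) → ZMod 2} (hf : (incMat D).transpose.mulVec f = 0)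
    {u v : Site 2} (hu : u ∈ D.verts) (hadj : triGraph.Adj u v) :
    fval D f (leftFace u v) = fval D f (leftFace v u) := by
  have hb : s(u, v) ∈ hBonds D := mem_hBonds D hadj (Or.inl hu)
  have := congrFun hf ⟨s(u, v), hb⟩
  rw [incMat_transpose_mulVec_apply D f hu hadj hb] at this
  exact (zmod2_add_eq_zero_iff _ _).1 this

/-- a kernel function is constant around every site of `G`. [cite: KhristoforovSmirnov2021, §1.2 (loop configurations, pp. 2–3)] -/
theorem fval_leftFaceDir_eq_of_ker {f : ↥(triFacesTouching D.verts) → ZMod 2} (hf : (incMat D).transpose.mulVec f = 0)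
    {u : Site 2} (hu : u ∈ D.verts) (k : Fin 6) : fval D f (leftFaceDir u k) = fval D f (leftFaceDir u 0) := by
  have hstep : ∀ k : Fin 6, fval D f (leftFaceDir u k) = fval D f (leftFaceDir u (k + 5)) := by
    intro k
    rw [← leftFace_add_triDir u k, ← leftFace_add_triDir_rev u k]
    exact fval_leftFace_eq_of_ker D hf hu (triGraph_adj_add_triDir u k)
  have h1 := hstep 1; have h2 := hstep 2; have h3 := hstep 3; have h4 := hstep 4; have h5 := hstep 5
  fin_cases k
  · rfl
  · exact h1
  · exact h2.trans h1
  · exact h3.trans (h2.trans h1)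
  · exact h4.trans (h3.trans (h2.trans h1))
  · exact h5.trans (h4.trans (h3.trans (h2.trans h1)))

/-- a kernel function takes the same reference value at adjacent sites of `G`. [cite: KhristoforovSmirnov2021, §1.2 (loop configurations, pp. 2–3)] -/
theorem fval_base_eq_of_adj_of_ker {f : ↥(triFacesTouching D.verts) → ZMod 2} (hf : (incMat D).transpose.mulVec f = 0)
    {u v : Site 2} (hu : u ∈ D.verts) (hv : v ∈ D.verts) (hadj : triGraph.Adj u v) :
    fval D f (leftFaceDir u 0) = fval D f (leftFaceDir v 0) := by
  -- the face left of `u → v` lies at `u` and at `v`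
  obtain ⟨k, rfl⟩ := (triGraph_adj_iff_triDir u v).1 hadj
  have hF : leftFaceDir u k ∈ facesAt (u + triDir k) := by
    rw [mem_facesAt, RemovableAt.hexFaceVertices_leftFaceDir]; simp
  rw [facesAt_eq_image_leftFaceDir] at hF
  obtain ⟨k', -, hk'⟩ := Finset.mem_image.1 hF
  rw [← fval_leftFaceDir_eq_of_ker D hf hu k, ← fval_leftFaceDir_eq_of_ker D hf hv k', hk']

/-- **the kernel of the coboundary consists of constant functions** (`G` connected, every face touching `G` at a
site of `G`). [cite: KhristoforovSmirnov2021, §1.2 (loop configurations, pp. 2–3)] -/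
theorem const_of_ker {f : ↥(triFacesTouching D.verts) → ZMod 2} (hf : (incMat D).transpose.mulVec f = 0)
    (F F' : ↥(triFacesTouching D.verts)) : f F = f F' := by
  -- reference values agree along `G`
  have hG : ∀ u, u ∈ D.verts → fval D f (leftFaceDir u 0) = fval D f (leftFaceDir D.base.1 0) := by
    intro u hu
    have hb : D.base.1 ∈ D.verts := (mem_triBdryDarts.1 D.base_mem).1
    obtain ⟨p⟩ := D.connected.preconnected ⟨D.base.1, Finset.mem_coe.2 hb⟩ ⟨u, Finset.mem_coe.2 hu⟩
    suffices h : ∀ (a b : ↥((D.verts : Finset (Site 2)) : Set (Site 2)))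
        (q : (triGraph.induce ((D.verts : Finset (Site 2)) : Set (Site 2))).Walk a b),
        fval D f (leftFaceDir (a : Site 2) 0) = fval D f (leftFaceDir (b : Site 2) 0) from (h _ _ p).symm
    intro a b q
    induction q with
    | nil => rfl
    | @cons u' x' b' hadj q' ih =>
      have hadj' : triGraph.Adj (u' : Site 2) (x' : Site 2) := hadj
      exact (fval_base_eq_of_adj_of_ker D hf (Finset.mem_coe.1 u'.2) (Finset.mem_coe.1 x'.2) hadj').trans ih
  -- every face touching `G` is a face at a site of `G`
  have hF : ∀ F : ↥(triFacesTouching D.verts), f F = fval D f (leftFaceDir D.base.1 0) := by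
    intro F
    obtain ⟨u, hu, huF⟩ := mem_triFacesTouching.1 F.2
    have hmem : F.1 ∈ facesAt u := mem_facesAt.2 huF
    rw [facesAt_eq_image_leftFaceDir] at hmem
    obtain ⟨k, -, hk⟩ := Finset.mem_image.1 hmem
    rw [← hG u hu, ← fval_leftFaceDir_eq_of_ker D hf hu k, hk, fval_of_mem D f F.2]
  rw [hF F, hF F']


/-! #### Dimension count over `𝔽₂`: the cycle space of `H_G` has `2 ^ #G` elements -/

/-- the faces touching `G` are nonempty. [cite: KhristoforovSmirnov2021, §1.2 (loop configurations, pp. 2–3)] -/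
private theorem touching_nonempty : (triFacesTouching D.verts).Nonempty :=
  ⟨_, leftFace_mem_touching D (mem_triBdryDarts.1 D.base_mem).1 (mem_triBdryDarts.1 D.base_mem).2.2⟩

/-- the constant function `1` is a cocycle: every bond has two faces. [cite: KhristoforovSmirnov2021, §1.2 (loop configurations, pp. 2–3)] -/
theorem transpose_mulVec_const_one : (incMat D).transpose.mulVec (fun _ => (1 : ZMod 2)) = 0 := by
  funext b
  obtain ⟨u, v, hb', hu, hadj⟩ := exists_rep_of_mem_hBonds D b.2
  have hb'' : s(u, v) ∈ hBonds D := hb' ▸ b.2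
  have : b = ⟨s(u, v), hb''⟩ := Subtype.ext hb'
  rw [this, incMat_transpose_mulVec_apply D _ hu hadj hb'', fval_of_mem D _ (leftFace_mem_touching D hu hadj),
    fval_of_mem D _ (leftFace_symm_mem_touching D hu hadj), Pi.zero_apply]
  decide

/-- **the kernel of the coboundary is the line of constants.** [cite: KhristoforovSmirnov2021, §1.2 (loop configurations, pp. 2–3)] -/
theorem ker_transpose_eq_span :
    LinearMap.ker (incMat D).transpose.mulVecLin = Submodule.span (ZMod 2) {fun _ => (1 : ZMod 2)} := by
  obtain ⟨F₀, hF₀⟩ := touching_nonempty D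
  ext f
  rw [LinearMap.mem_ker, Matrix.mulVecLin_apply, Submodule.mem_span_singleton]
  constructor
  · intro hf
    refine ⟨f ⟨F₀, hF₀⟩, ?_⟩
    funext F
    rw [Pi.smul_apply, smul_eq_mul, mul_one]
    exact (const_of_ker D hf F ⟨F₀, hF₀⟩).symm
  · rintro ⟨a, rfl⟩
    rw [Matrix.mulVec_smul, transpose_mulVec_const_one, smul_zero]

/-- `finrank (ker Mᵀ) = 1`. [cite: KhristoforovSmirnov2021, §1.2 (loop configurations, pp. 2–3)] -/
theorem finrank_ker_transpose : Module.finrank (ZMod 2) ↥(LinearMap.ker (incMat D).transpose.mulVecLin) = 1 := by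
  obtain ⟨F₀, hF₀⟩ := touching_nonempty D
  rw [ker_transpose_eq_span]
  refine finrank_span_singleton ?_
  intro h
  have := congrFun h ⟨F₀, hF₀⟩
  rw [Pi.zero_apply] at this
  exact one_ne_zero this

/-- **the rank of the incidence matrix is `#faces − 1`.** [cite: KhristoforovSmirnov2021, §1.2 (loop configurations, pp. 2–3)] -/
theorem rank_incMat_add_one : (incMat D).rank + 1 = #(triFacesTouching D.verts) := by
  classical
  have h := LinearMap.finrank_range_add_finrank_ker (incMat D).transpose.mulVecLin
  rw [finrank_ker_transpose, Module.finrank_fintype_fun_eq_card, Fintype.card_coe] at h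
  rw [← Matrix.rank_transpose]
  exact h

/-- **the cycle space of `H_G` has dimension `#G`** (`#E − (#V − 1)` with the Euler count). [cite: KhristoforovSmirnov2021, §1.2 (loop configurations, pp. 2–3)] -/
theorem finrank_ker_incMat : Module.finrank (ZMod 2) ↥(LinearMap.ker (incMat D).mulVecLin) = #D.verts := by
  classical
  have h := LinearMap.finrank_range_add_finrank_ker (incMat D).mulVecLin
  rw [Module.finrank_fintype_fun_eq_card, Fintype.card_coe] at h
  have hr : Module.finrank (ZMod 2) ↥(LinearMap.range (incMat D).mulVecLin) = (incMat D).rank := rfl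
  rw [hr] at h
  have h1 := rank_incMat_add_one D
  have h2 := card_hBonds_add_one D
  omega

/-- hence it has `2 ^ #G` elements. [cite: KhristoforovSmirnov2021, §1.2 (loop configurations, pp. 2–3)] -/
theorem card_ker_incMat : Nat.card ↥(LinearMap.ker (incMat D).mulVecLin) = 2 ^ #D.verts := by
  classical
  rw [Nat.card_eq_fintype_card, Module.card_eq_pow_finrank (K := ZMod 2) (V := ↥(LinearMap.ker (incMat D).mulVecLin)),
    ZMod.card, finrank_ker_incMat]

/-! #### Indicators and the count of edge sets with prescribed parity -/

/-- Auxiliary. [folklore] -/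
private theorem natCast_eq_ite_iff (n : ℕ) (c : Prop) [Decidable c] :
    (n : ZMod 2) = (if c then 1 else 0) ↔ (Odd n ↔ c) := by
  by_cases hc : c
  · rw [if_pos hc, ZMod.natCast_eq_one_iff_odd]; exact (iff_true_right hc).symm
  · rw [if_neg hc, ZMod.natCast_eq_zero_iff_even, ← Nat.not_odd_iff_even]; exact (iff_false_right hc).symm

/-- indicators determine the edge set. [cite: KhristoforovSmirnov2021, §1.2 (loop configurations, pp. 2–3)] -/
theorem indic_injective {ξ ξ' : Finset (Sym2 (Site 2))} (hξ : ξ ⊆ hBonds D) (hξ' : ξ' ⊆ hBonds D)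
    (h : indic D ξ = indic D ξ') : ξ = ξ' := by
  classical
  ext b
  constructor
  · intro hb
    have := congrFun h ⟨b, hξ hb⟩
    unfold indic at this
    rw [if_pos hb] at this
    by_contra hb'
    rw [if_neg hb'] at this
    exact absurd this (by decide)
  · intro hb
    have := congrFun h ⟨b, hξ' hb⟩
    unfold indic at this
    rw [if_pos hb] at this
    by_contra hb'
    rw [if_neg hb'] at this
    exact absurd this (by decide)

/-- every `𝔽₂`-vector on the bonds is the indicator of its support. [cite: KhristoforovSmirnov2021, §1.2 (loop configurations, pp. 2–3)] -/
theorem exists_indic_eq (g : ↥(hBonds D) → ZMod 2) : ∃ ξ : Finset (Sym2 (Site 2)), ξ ⊆ hBonds D ∧ indic D ξ = g := by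
  classical
  refine ⟨((hBonds D).attach.filter fun b => g b = 1).map ⟨Subtype.val, Subtype.val_injective⟩, ?_, ?_⟩
  · intro b hb
    rw [Finset.mem_map] at hb
    obtain ⟨b', -, rfl⟩ := hb
    exact b'.2
  · funext b
    unfold indic
    have hmem : b.1 ∈ ((hBonds D).attach.filter fun b => g b = 1).map ⟨Subtype.val, Subtype.val_injective⟩ ↔ g b = 1 := by
      rw [Finset.mem_map]
      constructor
      · rintro ⟨b', hb', he⟩
        have : b' = b := Subtype.ext he
        subst this
        exact (Finset.mem_filter.1 hb').2
      · intro hg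
        exact ⟨b, Finset.mem_filter.2 ⟨Finset.mem_attach _ _, hg⟩, rfl⟩
    by_cases hg : g b = 1
    · rw [if_pos (hmem.2 hg), hg]
    · rw [if_neg (fun h => hg (hmem.1 h))]
      have : ∀ x : ZMod 2, x ≠ 1 → 0 = x := by decide
      exact this _ hg

/-- **LoopCount holds for every domain**: `#W_Ω(y_{r+1}, …, y_{r+4}) = 2 ^ #G`. [cite: KhristoforovSmirnov2021, §1.2 (loop configurations, pp. 2–3)] -/
theorem sum_incMat_mulVec (g : ↥(hBonds D) → ZMod 2) : ∑ F, (incMat D).mulVec g F = 0 := by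
  classical
  have hcomm : ∑ F, (incMat D).mulVec g F = ∑ b, g b * ∑ F, (incMat D) F b := by
    simp only [Matrix.mulVec, dotProduct]
    rw [Finset.sum_comm]
    refine Finset.sum_congr rfl fun b _ => ?_
    rw [Finset.mul_sum]
    refine Finset.sum_congr rfl fun F _ => ?_
    ring
  rw [hcomm]
  refine Finset.sum_eq_zero fun b _ => ?_
  have hcol : ∑ F, (incMat D) F b = (incMat D).transpose.mulVec (fun _ => (1 : ZMod 2)) b := by
    simp only [Matrix.mulVec, dotProduct, Matrix.transpose_apply, mul_one]
  rw [hcol, transpose_mulVec_const_one, Pi.zero_apply, mul_zero]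

/-- **the range of the boundary map is the even hyperplane** `{t | Σ_F t F = 0}` (cokernel = constants + dimension count). [cite: KhristoforovSmirnov2021, §1.2 (loop configurations, pp. 2–3)] -/
theorem mem_range_incMat_iff (t : ↥(triFacesTouching D.verts) → ZMod 2) :
    t ∈ LinearMap.range (incMat D).mulVecLin ↔ ∑ F, t F = 0 := by
  classical
  -- the sum functional
  let s : (↥(triFacesTouching D.verts) → ZMod 2) →ₗ[ZMod 2] ZMod 2 :=
    { toFun := fun t => ∑ F, t F
      map_add' := fun a b => by simp only [Pi.add_apply, Finset.sum_add_distrib]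
      map_smul' := fun c a => by simp only [Pi.smul_apply, smul_eq_mul, RingHom.id_apply, Finset.mul_sum] }
  have hle : LinearMap.range (incMat D).mulVecLin ≤ LinearMap.ker s := by
    rintro t ⟨g, rfl⟩
    rw [LinearMap.mem_ker]
    exact sum_incMat_mulVec D g
  -- dimensions: range has finrank #T − 1, ker s has finrank #T − 1 (s is onto `ZMod 2`)
  obtain ⟨F₀, hF₀⟩ := touching_nonempty D
  have hs_apply : ∀ u : ↥(triFacesTouching D.verts) → ZMod 2, s u = ∑ F, u F := fun u => rfl
  have hs_surj : Function.Surjective s := by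
    intro a
    refine ⟨fun F => if F = ⟨F₀, hF₀⟩ then a else 0, ?_⟩
    rw [hs_apply]
    simp only [Finset.sum_ite_eq', Finset.mem_univ, if_true]
  have hker : Module.finrank (ZMod 2) ↥(LinearMap.ker s) + 1 = #(triFacesTouching D.verts) := by
    have h := LinearMap.finrank_range_add_finrank_ker s
    rw [LinearMap.range_eq_top.2 hs_surj, finrank_top, Module.finrank_self, Module.finrank_fintype_fun_eq_card,
      Fintype.card_coe] at h
    omega
  have hrange : Module.finrank (ZMod 2) ↥(LinearMap.range (incMat D).mulVecLin) + 1 = #(triFacesTouching D.verts) :=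
    rank_incMat_add_one D
  have heq : LinearMap.range (incMat D).mulVecLin = LinearMap.ker s :=
    Submodule.eq_of_le_of_finrank_eq hle (by omega)
  rw [heq, LinearMap.mem_ker]
  rfl

/-- **every even parity pattern has exactly `2 ^ #G` edge vectors with that boundary.** [cite: KhristoforovSmirnov2021, §1.2 (loop configurations, pp. 2–3)] -/
theorem card_filter_mulVec_eq {t : ↥(triFacesTouching D.verts) → ZMod 2} (ht : ∑ F, t F = 0) :
    #(Finset.univ.filter fun g : ↥(hBonds D) → ZMod 2 => (incMat D).mulVec g = t) = 2 ^ #D.verts := by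
  classical
  obtain ⟨g₀, hg₀⟩ := (mem_range_incMat_iff D t).2 ht
  rw [Matrix.mulVecLin_apply] at hg₀
  have hself : ∀ g : ↥(hBonds D) → ZMod 2, g + g = 0 := by
    intro g; funext b; exact (zmod2_add_eq_zero_iff _ _).2 rfl
  have h2 : #(Finset.univ.filter fun g : ↥(hBonds D) → ZMod 2 => (incMat D).mulVec g = t) =
      #(Finset.univ.filter fun g : ↥(hBonds D) → ZMod 2 => (incMat D).mulVec g = 0) := by
    refine Finset.card_bij (fun g _ => g + g₀) (fun g hg => ?_) (fun g _ g' _ h => add_right_cancel h) (fun h hh => ?_)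
    · refine Finset.mem_filter.2 ⟨Finset.mem_univ _, ?_⟩
      rw [Matrix.mulVec_add, (Finset.mem_filter.1 hg).2, hg₀]
      funext F; exact (zmod2_add_eq_zero_iff _ _).2 rfl
    · refine ⟨h + g₀, Finset.mem_filter.2 ⟨Finset.mem_univ _, ?_⟩, ?_⟩
      · rw [Matrix.mulVec_add, (Finset.mem_filter.1 hh).2, hg₀, zero_add]
      · rw [add_assoc, hself, add_zero]
  rw [h2, ← card_ker_incMat D, Nat.card_eq_fintype_card, Fintype.card_subtype]
  congr 1
  ext g
  simp only [Finset.mem_filter, Finset.mem_univ, true_and, LinearMap.mem_ker, Matrix.mulVecLin_apply]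

/-- **the number of edge sets of `H_G` with a prescribed EVEN set of odd faces is `2 ^ #G`** (e.g. the five corner faces
plus one interior face — the six-odd-point space of the five-point normalisation). [cite: KhristoforovSmirnov2021, §1.2 (loop configurations, pp. 2–3)] -/
theorem card_filter_parity_eq {O : Finset HexVertex} (hO : O ⊆ triFacesTouching D.verts) (heven : Even #O) :
    #((hBonds D).powerset.filter fun ξ => ∀ F ∈ triFacesTouching D.verts, (Odd (xiDeg ξ F) ↔ F ∈ O)) = 2 ^ #D.verts := by
  classical
  set t : ↥(triFacesTouching D.verts) → ZMod 2 := fun F => if F.1 ∈ O then 1 else 0 with ht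
  have hsum : ∑ F, t F = 0 := by
    rw [ht]
    simp only
    rw [Finset.sum_boole]
    have hc : #(Finset.univ.filter fun F : ↥(triFacesTouching D.verts) => F.1 ∈ O) = #O := by
      rw [← Finset.card_map ⟨Subtype.val, Subtype.val_injective⟩]
      congr 1
      ext F
      simp only [Finset.mem_map, Finset.mem_filter, Finset.mem_univ, true_and, Function.Embedding.coeFn_mk]
      constructor
      · rintro ⟨F', hF', rfl⟩; exact hF'
      · intro hF; exact ⟨⟨F, hO hF⟩, hF, rfl⟩
    rw [hc]
    exact (ZMod.natCast_eq_zero_iff_even).2 heven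
  rw [← card_filter_mulVec_eq D hsum]
  refine Finset.card_bij (fun ξ _ => indic D ξ) (fun ξ hξ => ?_) (fun ξ hξ ξ' hξ' h => ?_) (fun g hg => ?_)
  · obtain ⟨hξB, hpar⟩ := Finset.mem_filter.1 hξ
    have hξB' := Finset.mem_powerset.1 hξB
    refine Finset.mem_filter.2 ⟨Finset.mem_univ _, ?_⟩
    funext F
    rw [incMat_mulVec_indic D hξB' F, ht]
    exact (natCast_eq_ite_iff _ _).2 (hpar F.1 F.2)
  · exact indic_injective D (Finset.mem_powerset.1 (Finset.mem_filter.1 hξ).1)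
      (Finset.mem_powerset.1 (Finset.mem_filter.1 hξ').1) h
  · obtain ⟨ξ, hξB, rfl⟩ := exists_indic_eq D g
    refine ⟨ξ, Finset.mem_filter.2 ⟨Finset.mem_powerset.2 hξB, fun F hF => ?_⟩, rfl⟩
    have := congrFun (Finset.mem_filter.1 hg).2 ⟨F, hF⟩
    rw [incMat_mulVec_indic D hξB ⟨F, hF⟩, ht] at this
    exact (natCast_eq_ite_iff _ _).1 this


/-! ## Part II — corner faces and components of the side graph (generic `k`) -/


/-- Auxiliary. [folklore] -/
private theorem fin3_cases₅ (v j : Fin 3) : j = v ∨ j = v + 1 ∨ j = v + 2 := by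
  revert v j; decide

/-- Auxiliary. [folklore] -/
private theorem fin3_cases (v j : Fin 3) : j = v ∨ j = v + 1 ∨ j = v + 2 := by
  revert v j; decide

/-- The boundary dart preceding the `i`-th marked dart (same tail `v_i`, by `mark_pred`). [folklore] [cite: KhristoforovSmirnov2021, §1.2 (loop configurations, pp. 2–3)] -/
noncomputable def predDart (i : Fin nm) : Site 2 × Site 2 :=
  triBdryIter D.verts D.base (D.pos i + (D.bdryLen - 1))

/-- `F` is the CORNER FACE `y_i` of the `i`-th mark: the face of `𝕋` spanned by the marked site `v_i`,
the head of its marked dart and the head of the preceding dart (a type-II boundary vertex of `H_G`).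
[cite: BollobasRiordan2006, Ch. 7 §7.2.2 pp. 168–171] -/
def IsCornerFace (i : Fin nm) (F : HexVertex) : Prop :=
  hexFaceVertices F = {D.markSite i, (D.markDart i).2, (predDart D i).2}

/-- the marked dart is a boundary dart. [cite: KhristoforovSmirnov2021, §1.2 (loop configurations, pp. 2–3)] -/
theorem markDart_mem (i : Fin nm) : D.markDart i ∈ triBdryDarts D.verts := triBdryIter_mem D.base_mem _

/-- its predecessor is a boundary dart. [cite: KhristoforovSmirnov2021, §1.2 (loop configurations, pp. 2–3)] -/
theorem predDart_mem (i : Fin nm) : predDart D i ∈ triBdryDarts D.verts := triBdryIter_mem D.base_mem _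

/-- the marked site lies in `G`. [cite: KhristoforovSmirnov2021, §1.2 (loop configurations, pp. 2–3)] -/
theorem markSite_mem (i : Fin nm) : D.markSite i ∈ D.verts := (mem_triBdryDarts.1 (markDart_mem D i)).1

/-- the head of the marked dart lies outside `G`. [cite: KhristoforovSmirnov2021, §1.2 (loop configurations, pp. 2–3)] -/
theorem markDart_snd_not_mem (i : Fin nm) : (D.markDart i).2 ∉ D.verts := (mem_triBdryDarts.1 (markDart_mem D i)).2.1

/-- the head of the predecessor dart lies outside `G`. [cite: KhristoforovSmirnov2021, §1.2 (loop configurations, pp. 2–3)] -/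
theorem predDart_snd_not_mem (i : Fin nm) : (predDart D i).2 ∉ D.verts := (mem_triBdryDarts.1 (predDart_mem D i)).2.1

/-- the predecessor has the same tail `v_i` (`mark_pred`). [cite: KhristoforovSmirnov2021, §1.2 (loop configurations, pp. 2–3)] -/
theorem predDart_fst (i : Fin nm) : (predDart D i).1 = D.markSite i := D.mark_pred i

/-- the successor of the predecessor is the marked dart. [cite: KhristoforovSmirnov2021, §1.2 (loop configurations, pp. 2–3)] -/
theorem succ_predDart (i : Fin nm) : triBdrySucc D.verts (predDart D i) = D.markDart i := by
  unfold predDart TriMarkedDomain.markDart TriMarkedDomain.bdryLen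
  rw [← triBdryIter_succ, show D.pos i + (#(triBdryDarts D.verts) - 1) + 1 = D.pos i + #(triBdryDarts D.verts) by
    have := D.isTriDisc.card_pos; omega, D.isTriDisc.iter_add_card]

/-- the position of the marked dart. [cite: KhristoforovSmirnov2021, §1.2 (loop configurations, pp. 2–3)] -/
theorem dpos_markDart (i : Fin nm) : D.dpos (D.markDart i) = D.pos i := D.dpos_eq_of_iter_eq (D.pos_lt i) rfl

/-- the position after the predecessor is the mark. [cite: KhristoforovSmirnov2021, §1.2 (loop configurations, pp. 2–3)] -/
theorem dpos_predDart_succ (i : Fin nm) : (D.dpos (predDart D i) + 1) % #(triBdryDarts D.verts) = D.pos i := by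
  have h := D.dpos_succ (predDart_mem D i)
  rw [succ_predDart, dpos_markDart] at h
  exact h.symm

/-- a corner face is a type-II face at the marked site, its two outer vertices being the heads of the marked dart and of its
predecessor (in one of the two orders). [cite: BollobasRiordan2006, Ch. 7 §7.2.2 pp. 168–171] -/
theorem isCornerFace_typeII {i : Fin nm} {F : HexVertex} (h : IsCornerFace D i F) :
    ∃ v : Fin 3, faceVertex F v = D.markSite i ∧ faceVertex F (v + 1) ∉ D.verts ∧ faceVertex F (v + 2) ∉ D.verts ∧
      ((faceVertex F (v + 1) = (predDart D i).2 ∧ faceVertex F (v + 2) = (D.markDart i).2) ∨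
        (faceVertex F (v + 1) = (D.markDart i).2 ∧ faceVertex F (v + 2) = (predDart D i).2)) := by
  unfold IsCornerFace at h
  have hm : D.markSite i ∈ hexFaceVertices F := by rw [h]; simp
  obtain ⟨v, hv⟩ := mem_hexFaceVertices_iff_faceVertex.1 hm
  have hmem : ∀ w : Fin 3, faceVertex F w = D.markSite i ∨ faceVertex F w = (D.markDart i).2 ∨
      faceVertex F w = (predDart D i).2 := by
    intro w
    have := faceVertex_mem F w
    rw [h] at this
    simpa only [Finset.mem_insert, Finset.mem_singleton] using this
  have hne1 : faceVertex F (v + 1) ≠ D.markSite i := by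
    rw [hv]; intro e; exact absurd (add_eq_left.1 (faceVertex_injective F e)) (by decide)
  have hne2 : faceVertex F (v + 2) ≠ D.markSite i := by
    rw [hv]; intro e; exact absurd (add_eq_left.1 (faceVertex_injective F e)) (by decide)
  have hne12 : faceVertex F (v + 1) ≠ faceVertex F (v + 2) := by
    intro e; exact absurd (add_left_cancel (faceVertex_injective F e)) (by decide)
  have ho := markDart_snd_not_mem D i
  have ho' := predDart_snd_not_mem D i
  refine ⟨v, hv.symm, ?_, ?_, ?_⟩
  · rcases hmem (v + 1) with e | e | e
    · exact absurd e hne1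
    · rw [e]; exact ho
    · rw [e]; exact ho'
  · rcases hmem (v + 2) with e | e | e
    · exact absurd e hne2
    · rw [e]; exact ho
    · rw [e]; exact ho'
  · rcases hmem (v + 1) with e1 | e1 | e1
    · exact absurd e1 hne1
    · rcases hmem (v + 2) with e2 | e2 | e2
      · exact absurd e2 hne2
      · exact absurd (e1.trans e2.symm) hne12
      · exact Or.inr ⟨e1, e2⟩
    · rcases hmem (v + 2) with e2 | e2 | e2
      · exact absurd e2 hne2
      · exact Or.inl ⟨e1, e2⟩
      · exact absurd (e1.trans e2.symm) hne12


/-- a corner face is determined by its mark (a face is determined by its vertices, tree `hexFaceVertices_injective`). [cite: KhristoforovSmirnov2021, §1.2 (loop configurations, pp. 2–3)] -/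
theorem cornerFace_unique {i : Fin nm} {Y Y' : HexVertex} (h : IsCornerFace D i Y) (h' : IsCornerFace D i Y') : Y = Y' :=
  hexFaceVertices_injective (h.trans h'.symm)

/-- distinct marks have distinct corner faces. [cite: KhristoforovSmirnov2021, §1.2 (loop configurations, pp. 2–3)] -/
theorem cornerFace_idx_unique {i j : Fin nm} {Y : HexVertex} (h : IsCornerFace D i Y) (h' : IsCornerFace D j Y) : i = j := by
  obtain ⟨v, hv, hv1, hv2, -⟩ := isCornerFace_typeII D h
  obtain ⟨w, hw, hw1, hw2, -⟩ := isCornerFace_typeII D h'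
  have hwv : w = v := by
    rcases fin3_cases v w with e | e | e
    · exact e
    · exact absurd (e ▸ hw ▸ markSite_mem D j) hv1
    · exact absurd (e ▸ hw ▸ markSite_mem D j) hv2
  subst hwv
  exact D.mark_injective (show (triBdryIter D.verts D.base (D.pos i)).1 = (triBdryIter D.verts D.base (D.pos j)).1 from
    hv.symm.trans hw)

/-- a corner face touches `G`. [cite: KhristoforovSmirnov2021, §1.2 (loop configurations, pp. 2–3)] -/
theorem cornerFace_mem_touching {i : Fin nm} {Y : HexVertex} (h : IsCornerFace D i Y) : Y ∈ triFacesTouching D.verts := by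
  rw [mem_triFacesTouching]
  refine ⟨D.markSite i, markSite_mem D i, ?_⟩
  unfold IsCornerFace at h
  rw [h]; simp


/-- every mark has a corner face: the face left of the predecessor dart. [cite: KhristoforovSmirnov2021, §1.2 (loop configurations, pp. 2–3)] -/
theorem cornerFace_exists (j : Fin nm) : ∃ Y : HexVertex, IsCornerFace D j Y := by
  have hpd := predDart_mem D j
  obtain ⟨hm, ho', hadj⟩ := mem_triBdryDarts.1 hpd
  have hsucc := succ_predDart D j
  -- the successor keeps the tail, so the apex is outside and is the head of the marked dart
  have hapex : triLeftApex (predDart D j).1 (predDart D j).2 ∉ D.verts := by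
    intro hin
    have h1 : (triBdrySucc D.verts (predDart D j)).1 = triLeftApex (predDart D j).1 (predDart D j).2 := by
      rw [triBdrySucc, if_pos hin]
    rw [hsucc] at h1
    have h2 : (D.markDart j).1 = (predDart D j).1 := (predDart_fst D j).symm
    exact (triLeftApex_ne hadj).1 (h1.symm.trans h2)
  have hmark : D.markDart j = ((predDart D j).1, triLeftApex (predDart D j).1 (predDart D j).2) := by
    rw [← hsucc, triBdrySucc, if_neg hapex]
  refine ⟨leftFace (predDart D j).1 (predDart D j).2, ?_⟩
  unfold IsCornerFace
  rw [hexFaceVertices_leftFace hadj, ← predDart_fst D j, hmark]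
  simp only [Finset.pair_comm]

/-- a face with a side in `hBonds` touches `G`. [cite: KhristoforovSmirnov2021, §1.2 (loop configurations, pp. 2–3)] -/
theorem mem_touching_of_side_mem {F : HexVertex} {j : Fin 3} (h : side F j ∈ hBonds D) : F ∈ triFacesTouching D.verts := by
  obtain ⟨a, b, he, ha, -⟩ := exists_rep_of_mem_hBonds D h
  have : a ∈ hexFaceVertices F := by
    have hinc := inc_side F j
    rw [he] at hinc
    exact (inc_mk_iff.1 hinc).1
  exact mem_triFacesTouching.2 ⟨a, ha, this⟩

/-- at most two sides if one side is missing. [folklore] -/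
private theorem card_filter_le_two_of_not {p : Fin 3 → Prop} [DecidablePred p] {j₀ : Fin 3} (h : ¬ p j₀) :
    #((Finset.univ : Finset (Fin 3)).filter p) ≤ 2 := by
  have hsub : (Finset.univ : Finset (Fin 3)).filter p ⊆ Finset.univ.erase j₀ := by
    intro j hj
    rw [Finset.mem_erase]
    exact ⟨fun e => h (e ▸ (Finset.mem_filter.1 hj).2), Finset.mem_univ _⟩
  exact (Finset.card_le_card hsub).trans (by rw [Finset.card_erase_of_mem (Finset.mem_univ _)]; simp)

/-- a corner face has a side outside `hBonds` (the side joining its two outside vertices). [cite: KhristoforovSmirnov2021, §1.2 (loop configurations, pp. 2–3)] -/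
theorem exists_side_not_mem_hBonds_of_corner {i : Fin nm} {F : HexVertex} (h : IsCornerFace D i F) :
    ∃ j : Fin 3, side F j ∉ hBonds D := by
  obtain ⟨w, -, hw1, hw2, -⟩ := isCornerFace_typeII D h
  refine ⟨w, fun hmem => ?_⟩
  obtain ⟨a, b, he, ha, -⟩ := exists_rep_of_mem_hBonds D hmem
  unfold side at he
  rcases Sym2.eq_iff.1 he with ⟨h1, -⟩ | ⟨-, h2⟩
  · exact hw1 (h1 ▸ ha)
  · exact hw2 (h2 ▸ ha)


/-- an edge of the side graph of `ξ ⊆ hBonds` starts at a face touching `G`. [cite: KhristoforovSmirnov2021, §1.2 (loop configurations, pp. 2–3)] -/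
theorem sideGraph_adj_touching {ξ : Finset (Sym2 (Site 2))} (hξ : ξ ⊆ hBonds D) {F F' : HexVertex}
    (h : (sideGraph ξ).Adj F F') : F ∈ triFacesTouching D.verts := by
  obtain ⟨j, -, hj⟩ := h
  exact mem_touching_of_side_mem D (hξ hj)

/-- the component of a touching face in the side graph of `ξ ⊆ hBonds` consists of touching faces (hence is finite). [cite: KhristoforovSmirnov2021, §1.2 (loop configurations, pp. 2–3)] -/
theorem supp_subset_touching {ξ : Finset (Sym2 (Site 2))} (hξ : ξ ⊆ hBonds D) {Y : HexVertex} (hY : Y ∈ triFacesTouching D.verts) :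
    ((sideGraph ξ).connectedComponentMk Y).supp ⊆ ↑(triFacesTouching D.verts) := by
  intro F hF
  have hF' := (SimpleGraph.ConnectedComponent.mem_supp_iff _ _).1 hF
  obtain ⟨p⟩ := SimpleGraph.ConnectedComponent.exact hF'
  cases p with
  | nil => exact hY
  | cons hadj _ => exact sideGraph_adj_touching D hξ hadj

/-- **the odd faces of a component of the side graph** (all side counts `≤ 2`): the number of faces of odd side count that a
given touching face reaches is EVEN and AT MOST TWO — packaged as: from an odd face `Y₁` one reaches an odd face `Y₂ ≠ Y₁`,
and no third. [cite: KhristoforovSmirnov2021, §1.2 (loop configurations, pp. 2–3)] -/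
theorem odd_component {ξ : Finset (Sym2 (Site 2))} (hξ : ξ ⊆ hBonds D) (hdeg : ∀ F, xiDeg ξ F ≤ 2) {Y₁ : HexVertex}
    (h1 : Y₁ ∈ triFacesTouching D.verts) (ho1 : Odd (xiDeg ξ Y₁)) :
    (∃ Y₂, Y₂ ≠ Y₁ ∧ Odd (xiDeg ξ Y₂) ∧ (sideGraph ξ).Reachable Y₁ Y₂) ∧
    (∀ Y₂ Y₃, (sideGraph ξ).Reachable Y₁ Y₂ → (sideGraph ξ).Reachable Y₁ Y₃ → Odd (xiDeg ξ Y₂) → Odd (xiDeg ξ Y₃) →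
      Y₂ ≠ Y₁ → Y₃ ≠ Y₁ → Y₂ = Y₃) := by
  classical
  set C := (sideGraph ξ).connectedComponentMk Y₁ with hC
  have hreach : ∀ F, (sideGraph ξ).Reachable Y₁ F → F ∈ C.supp := by
    intro F h
    rw [SimpleGraph.ConnectedComponent.mem_supp_iff, hC]
    exact (SimpleGraph.ConnectedComponent.sound h).symm
  have hreach' : ∀ F, F ∈ C.supp → (sideGraph ξ).Reachable Y₁ F := by
    intro F hF
    have hF' := (SimpleGraph.ConnectedComponent.mem_supp_iff _ _).1 hF
    rw [hC] at hF'
    exact (SimpleGraph.ConnectedComponent.exact hF').symm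
  have hsub : ∀ v : C.supp, ∀ w : HexVertex, (sideGraph ξ).Adj v w → w ∈ C.supp := by
    intro v w hw
    have hv := v.2
    rw [SimpleGraph.ConnectedComponent.mem_supp_iff] at hv ⊢
    rw [← hv]
    exact SimpleGraph.ConnectedComponent.sound hw.symm.reachable
  have hfin : (C.supp).Finite := (Finset.finite_toSet _).subset (supp_subset_touching D hξ h1)
  haveI : Fintype C.supp := hfin.fintype
  have hdegC : ∀ v : C.supp, C.toSimpleGraph.degree v = xiDeg ξ v := by
    intro v
    rw [← SimpleGraph.card_neighborFinset_eq_degree]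
    unfold xiDeg
    symm
    refine Finset.card_bij (fun j hj => (⟨oppFace (v : HexVertex) j, hsub v _ ⟨j, rfl, (Finset.mem_filter.1 hj).2⟩⟩ : C.supp))
      (fun j hj => ?_) (fun j₁ _ j₂ _ h => ?_) (fun w hw => ?_)
    · rw [SimpleGraph.mem_neighborFinset]
      exact ⟨j, rfl, (Finset.mem_filter.1 hj).2⟩
    · exact oppFace_injective' _ (congrArg Subtype.val h)
    · rw [SimpleGraph.mem_neighborFinset] at hw
      obtain ⟨j, hj, hb⟩ := hw
      exact ⟨j, Finset.mem_filter.2 ⟨Finset.mem_univ _, hb⟩, Subtype.ext hj.symm⟩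
  have hle : ∀ v : C.supp, C.toSimpleGraph.degree v ≤ 2 := fun v => (hdegC v).symm ▸ hdeg v
  have hone : ∀ v : C.supp, Odd (xiDeg ξ v) → C.toSimpleGraph.degree v = 1 := by
    intro v hv
    rw [← hdegC] at hv
    have := hle v
    obtain ⟨m, hm⟩ := hv
    omega
  constructor
  · -- existence: the odd-degree vertices of `C.toSimpleGraph` are even in number and contain `Y₁`
    have heven0 : Even #(Finset.univ.filter fun v : C.supp => Odd (C.toSimpleGraph.degree v)) :=
      SimpleGraph.even_card_odd_degree_vertices C.toSimpleGraph
    have hseteq : (Finset.univ.filter fun v : C.supp => Odd (C.toSimpleGraph.degree v)) =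
        (Finset.univ.filter fun v : C.supp => Odd (xiDeg ξ (v : HexVertex))) := by
      ext v
      simp only [Finset.mem_filter, Finset.mem_univ, true_and, hdegC]
    have heven : Even #(Finset.univ.filter fun v : C.supp => Odd (xiDeg ξ (v : HexVertex))) := by
      rw [← hseteq]; exact heven0
    have hY₁mem : (⟨Y₁, hreach _ SimpleGraph.Reachable.rfl⟩ : C.supp) ∈
        (Finset.univ.filter fun v : C.supp => Odd (xiDeg ξ (v : HexVertex))) :=
      Finset.mem_filter.2 ⟨Finset.mem_univ _, ho1⟩
    have hcard : 1 < #(Finset.univ.filter fun v : C.supp => Odd (xiDeg ξ (v : HexVertex))) := by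
      have hpos : 0 < #(Finset.univ.filter fun v : C.supp => Odd (xiDeg ξ (v : HexVertex))) :=
        Finset.card_pos.2 ⟨_, hY₁mem⟩
      obtain ⟨k, hk⟩ := heven
      omega
    obtain ⟨w, hw, hne⟩ := Finset.exists_mem_ne hcard ⟨Y₁, hreach _ SimpleGraph.Reachable.rfl⟩
    refine ⟨w, fun e => hne (Subtype.ext e), (Finset.mem_filter.1 hw).2, hreach' _ w.2⟩
  · -- at most two: three odd (= degree one) vertices contradict the handshake in a connected graph of max degree two
    intro Y₂ Y₃ h12 h13 ho2 ho3 n21 n31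
    by_contra n23
    let S : Finset C.supp := {⟨Y₁, hreach _ SimpleGraph.Reachable.rfl⟩, ⟨Y₂, hreach _ h12⟩, ⟨Y₃, hreach _ h13⟩}
    have hS : S.card = 3 := by
      refine Finset.card_eq_three.2 ⟨⟨Y₁, hreach _ SimpleGraph.Reachable.rfl⟩, ⟨Y₂, hreach _ h12⟩, ⟨Y₃, hreach _ h13⟩, ?_, ?_, ?_, rfl⟩
      · exact fun h => n21 (congrArg Subtype.val h).symm
      · exact fun h => n31 (congrArg Subtype.val h).symm
      · exact fun h => n23 (congrArg Subtype.val h)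
    have hSone : ∀ w ∈ S, C.toSimpleGraph.degree w = 1 := by
      intro w hw
      simp only [S, Finset.mem_insert, Finset.mem_singleton] at hw
      rcases hw with rfl | rfl | rfl
      · exact hone _ ho1
      · exact hone _ ho2
      · exact hone _ ho3
    have hbound : ∑ w : C.supp, C.toSimpleGraph.degree w + 3 ≤ 2 * Fintype.card C.supp := by
      have hterm : ∀ w : C.supp, C.toSimpleGraph.degree w + (if w ∈ S then 1 else 0) ≤ 2 := by
        intro w
        split_ifs with hw
        · rw [hSone w hw]
        · have := hle w; omega
      have hsum := Finset.sum_le_sum fun w (_ : w ∈ (Finset.univ : Finset C.supp)) => hterm w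
      rw [Finset.sum_add_distrib, Finset.sum_const, smul_eq_mul, Finset.card_univ] at hsum
      have hind : ∑ w : C.supp, (if w ∈ S then 1 else 0) = 3 := by
        rw [Finset.sum_boole, Finset.filter_mem_eq_inter, Finset.univ_inter, hS]; rfl
      omega
    have hhand := C.toSimpleGraph.sum_degrees_eq_twice_card_edges
    have hconn := (SimpleGraph.ConnectedComponent.connected_toSimpleGraph C).card_vert_le_card_edgeSet_add_one
    rw [Nat.card_eq_fintype_card, Nat.card_eq_fintype_card, ← SimpleGraph.edgeFinset_card] at hconn
    have hconn' : Fintype.card C.supp ≤ #C.toSimpleGraph.edgeFinset + 1 := hconn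
    have hhand' : ∑ w : C.supp, C.toSimpleGraph.degree w = 2 * #C.toSimpleGraph.edgeFinset := hhand
    omega

/-- two touching faces incident to the same `H_G`-bond: a third incident touching face is one of them. [cite: KhristoforovSmirnov2021, §1.2 (loop configurations, pp. 2–3)] -/
theorem eq_or_eq_of_inc_three {e : Sym2 (Site 2)} (he : e ∈ hBonds D) {F₁ F₂ F₃ : HexVertex}
    (h₁ : F₁ ∈ triFacesTouching D.verts) (h₂ : F₂ ∈ triFacesTouching D.verts) (h₃ : F₃ ∈ triFacesTouching D.verts)
    (i₁ : Inc F₁ e) (i₂ : Inc F₂ e) (i₃ : Inc F₃ e) (h12 : F₁ ≠ F₂) : F₃ = F₁ ∨ F₃ = F₂ := by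
  classical
  obtain ⟨a, b, rfl, ha, hab⟩ := exists_rep_of_mem_hBonds D he
  have hpair := filter_inc_eq_pair D ha hab
  have hmem : ∀ F, F ∈ triFacesTouching D.verts → Inc F s(a, b) → F = leftFace a b ∨ F = leftFace b a := by
    intro F hF hinc
    have : F ∈ (triFacesTouching D.verts).filter (fun F => Inc F s(a, b)) := Finset.mem_filter.2 ⟨hF, hinc⟩
    rw [hpair, Finset.mem_insert, Finset.mem_singleton] at this
    exact this
  rcases hmem F₁ h₁ i₁ with e1 | e1 <;> rcases hmem F₂ h₂ i₂ with e2 | e2 <;> rcases hmem F₃ h₃ i₃ with e3 | e3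
  · exact absurd (e1.trans e2.symm) h12
  · exact absurd (e1.trans e2.symm) h12
  · exact Or.inl (e3.trans e1.symm)
  · exact Or.inr (e3.trans e2.symm)
  · exact Or.inr (e3.trans e2.symm)
  · exact Or.inl (e3.trans e1.symm)
  · exact absurd (e1.trans e2.symm) h12
  · exact absurd (e1.trans e2.symm) h12

/-- a face with two distinct vertices in `G` is not a corner face. [cite: KhristoforovSmirnov2021, §1.2 (loop configurations, pp. 2–3)] -/
theorem not_corner_of_two_mem {F : HexVertex} {u v : Site 2} (hu : u ∈ hexFaceVertices F) (hv : v ∈ hexFaceVertices F)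
    (huG : u ∈ D.verts) (hvG : v ∈ D.verts) (huv : u ≠ v) (i : Fin nm) : ¬ IsCornerFace D i F := by
  intro hc
  obtain ⟨w, -, hw1, hw2, -⟩ := isCornerFace_typeII D hc
  have key : ∀ z ∈ hexFaceVertices F, z ∈ D.verts → z = faceVertex F w := by
    intro z hz hzG
    obtain ⟨i, rfl⟩ := mem_hexFaceVertices_iff_faceVertex.1 hz
    rcases fin3_cases₅ w i with e | e | e
    · rw [e]
    · exact absurd (e ▸ hzG) hw1
    · exact absurd (e ▸ hzG) hw2
  exact huv ((key u hu huG).trans (key v hv hvG).symm)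

/-- **removing the component of a face**: the sides of `ξ` not on any face reachable from `s₀`. The remaining set has side
count `0` on the component and the old side count off it, and linking off the component is unchanged. [cite: KhristoforovSmirnov2021, §1.2 (loop configurations, pp. 2–3)] -/
theorem restrict_off_component {ξ : Finset (Sym2 (Site 2))} (hξ : ξ ⊆ hBonds D) (s₀ : HexVertex)
    (ξ' : Finset (Sym2 (Site 2)))
    (hξ' : ∀ e, e ∈ ξ' ↔ e ∈ ξ ∧ ¬ ∃ F, (sideGraph ξ).Reachable s₀ F ∧ ∃ i : Fin 3, e = side F i) :
    (∀ F, (sideGraph ξ).Reachable s₀ F → xiDeg ξ' F = 0) ∧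
    (∀ F, ¬ (sideGraph ξ).Reachable s₀ F → xiDeg ξ' F = xiDeg ξ F) ∧
    (∀ Y Y', ¬ (sideGraph ξ).Reachable s₀ Y → (XiLinked ξ Y Y' ↔ XiLinked ξ' Y Y')) := by
  classical
  -- a side of an unreachable face lying in ξ is not a side of any reachable face
  have key : ∀ F (i : Fin 3), ¬ (sideGraph ξ).Reachable s₀ F → side F i ∈ ξ →
      ¬ ∃ F'', (sideGraph ξ).Reachable s₀ F'' ∧ ∃ i'' : Fin 3, side F i = side F'' i'' := by
    rintro F i hF hmem ⟨F'', hreach, i'', he⟩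
    have heB : side F i ∈ hBonds D := hξ hmem
    have h1 : F ∈ triFacesTouching D.verts := mem_touching_of_side_mem D heB
    have h2 : oppFace F i ∈ triFacesTouching D.verts :=
      mem_touching_of_side_mem D (j := oppIdx F i) (by rw [side_oppFace_oppIdx]; exact heB)
    have h3 : F'' ∈ triFacesTouching D.verts := mem_touching_of_side_mem D (j := i'') (by rw [← he]; exact heB)
    rcases eq_or_eq_of_inc_three D heB h1 h2 h3 (inc_side F i) (by rw [← side_oppFace_oppIdx F i]; exact inc_side _ _)
        (by rw [he]; exact inc_side _ _) (fun e => (hexGraph_adj_oppFace F i).ne e) with rfl | rfl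
    · exact hF hreach
    · exact hF (hreach.trans ⟨SimpleGraph.Walk.cons ⟨oppIdx F i, by rw [oppFace_oppFace], by rw [side_oppFace_oppIdx]; exact hmem⟩ SimpleGraph.Walk.nil⟩)
  refine ⟨fun F hF => ?_, fun F hF => ?_, fun Y Y' hY => ?_⟩
  · unfold xiDeg
    rw [Finset.card_eq_zero, Finset.filter_eq_empty_iff]
    intro i _ hi
    have := (hξ' _).1 hi
    exact this.2 ⟨F, hF, i, rfl⟩
  · unfold xiDeg
    congr 1
    refine Finset.filter_congr fun i _ => ?_
    rw [hξ']
    constructor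
    · exact fun h => h.1
    · exact fun h => ⟨h, key F i hF h⟩
  · constructor
    · intro h
      unfold XiLinked at h ⊢
      induction h with
      | refl => exact Relation.ReflTransGen.refl
      | @tail b c hab hbc ih =>
        obtain ⟨i, hc, hmem⟩ := hbc
        have hb : ¬ (sideGraph ξ).Reachable s₀ b := by
          intro hsb
          apply hY
          have hYb : (sideGraph ξ).Reachable Y b := (xiLinked_iff_reachable ξ Y b).1 hab
          exact hsb.trans hYb.symm
        refine ih.tail ⟨i, hc, ?_⟩
        rw [hξ']
        exact ⟨hmem, key b i hb hmem⟩
    · intro h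
      unfold XiLinked at h ⊢
      induction h with
      | refl => exact Relation.ReflTransGen.refl
      | tail _ hbc ih =>
        obtain ⟨i, hc, hmem⟩ := hbc
        exact ih.tail ⟨i, hc, ((hξ' _).1 hmem).1⟩

/-- reachability in the side graph of `ξ ⊆ hBonds` from a touching face stays among touching faces. [cite: KhristoforovSmirnov2021, §1.2 (loop configurations, pp. 2–3)] -/
theorem touching_of_reachable {ξ : Finset (Sym2 (Site 2))} (hξ : ξ ⊆ hBonds D) {Y F : HexVertex}
    (hY : Y ∈ triFacesTouching D.verts) (h : (sideGraph ξ).Reachable Y F) : F ∈ triFacesTouching D.verts := by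
  have := supp_subset_touching D hξ hY
    ((SimpleGraph.ConnectedComponent.mem_supp_iff _ _).2 (SimpleGraph.ConnectedComponent.sound h.symm))
  exact Finset.mem_coe.1 this

/-- the corner face `y_i` (exists and is unique: `cornerFace_exists`, `cornerFace_unique`). [folklore] [cite: KhristoforovSmirnov2021, §1.2 (loop configurations, pp. 2–3)] -/
noncomputable def yc (i : Fin nm) : HexVertex := (cornerFace_exists D i).choose

/-- Auxiliary. [cite: KhristoforovSmirnov2021, §1.2 (loop configurations, pp. 2–3)] -/
theorem yc_spec (i : Fin nm) : IsCornerFace D i (yc D i) := (cornerFace_exists D i).choose_spec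

/-- Auxiliary. [cite: KhristoforovSmirnov2021, §1.2 (loop configurations, pp. 2–3)] -/
theorem eq_yc {i : Fin nm} {Y : HexVertex} (h : IsCornerFace D i Y) : Y = yc D i := cornerFace_unique D h (yc_spec D i)

/-- Auxiliary. [cite: KhristoforovSmirnov2021, §1.2 (loop configurations, pp. 2–3)] -/
theorem yc_injective : Function.Injective (yc D) := fun i i' h =>
  cornerFace_idx_unique D (yc_spec D i) (h ▸ yc_spec D i')

/-- Auxiliary. [cite: KhristoforovSmirnov2021, §1.2 (loop configurations, pp. 2–3)] -/
theorem isCornerFace_iff_eq_yc {i : Fin nm} {Y : HexVertex} : IsCornerFace D i Y ↔ Y = yc D i :=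
  ⟨eq_yc D, fun h => h ▸ yc_spec D i⟩


/-- the `k` corner faces. [folklore] [cite: KhristoforovSmirnov2021, §1.2 (loop configurations, pp. 2–3)] -/
noncomputable def corners : Finset HexVertex := Finset.univ.image (yc D)

/-- the corner faces `y_i, i ≠ j`. [folklore] [cite: KhristoforovSmirnov2021, §1.2 (loop configurations, pp. 2–3)] -/
noncomputable def cornersNe (j : Fin nm) : Finset HexVertex := (Finset.univ.filter fun i : Fin nm => i ≠ j).image (yc D)

/-- Auxiliary. [cite: KhristoforovSmirnov2021, §1.2 (loop configurations, pp. 2–3)] -/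
theorem mem_corners {F : HexVertex} : F ∈ corners D ↔ ∃ i, F = yc D i := by
  unfold corners
  rw [Finset.mem_image]
  constructor
  · rintro ⟨i, -, rfl⟩; exact ⟨i, rfl⟩
  · rintro ⟨i, rfl⟩; exact ⟨i, Finset.mem_univ _, rfl⟩

/-- Auxiliary. [cite: KhristoforovSmirnov2021, §1.2 (loop configurations, pp. 2–3)] -/
theorem mem_cornersNe {j : Fin nm} {F : HexVertex} : F ∈ cornersNe D j ↔ ∃ i, i ≠ j ∧ F = yc D i := by
  unfold cornersNe
  rw [Finset.mem_image]
  constructor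
  · rintro ⟨i, hi, rfl⟩; exact ⟨i, (Finset.mem_filter.1 hi).2, rfl⟩
  · rintro ⟨i, hi, rfl⟩; exact ⟨i, Finset.mem_filter.2 ⟨Finset.mem_univ _, hi⟩, rfl⟩

/-- Auxiliary. [cite: KhristoforovSmirnov2021, §1.2 (loop configurations, pp. 2–3)] -/
theorem yc_mem_corners (i : Fin nm) : yc D i ∈ corners D := (mem_corners D).2 ⟨i, rfl⟩

/-- Auxiliary. [cite: KhristoforovSmirnov2021, §1.2 (loop configurations, pp. 2–3)] -/
theorem yc_not_mem_cornersNe (j : Fin nm) : yc D j ∉ cornersNe D j := fun h => by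
  obtain ⟨i, hi, h⟩ := (mem_cornersNe D).1 h
  exact hi (yc_injective D h).symm

/-- Auxiliary. [cite: KhristoforovSmirnov2021, §1.2 (loop configurations, pp. 2–3)] -/
theorem yc_mem_cornersNe {i j : Fin nm} (h : i ≠ j) : yc D i ∈ cornersNe D j := (mem_cornersNe D).2 ⟨i, h, rfl⟩

/-- Auxiliary. [cite: KhristoforovSmirnov2021, §1.2 (loop configurations, pp. 2–3)] -/
theorem mem_corners_iff_or (j : Fin nm) {F : HexVertex} : F ∈ corners D ↔ F = yc D j ∨ F ∈ cornersNe D j := by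
  rw [mem_corners, mem_cornersNe]
  constructor
  · rintro ⟨i, rfl⟩
    by_cases hij : i = j
    · exact Or.inl (by rw [hij])
    · exact Or.inr ⟨i, hij, rfl⟩
  · rintro (h | ⟨i, -, h⟩)
    · exact ⟨j, h⟩
    · exact ⟨i, h⟩

/-- Auxiliary. [cite: KhristoforovSmirnov2021, §1.2 (loop configurations, pp. 2–3)] -/
theorem cornersNe_subset_corners (j : Fin nm) : cornersNe D j ⊆ corners D := fun _ h => (mem_corners_iff_or D j).2 (Or.inr h)

/-- Auxiliary. [cite: KhristoforovSmirnov2021, §1.2 (loop configurations, pp. 2–3)] -/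
theorem not_mem_corners_iff {F : HexVertex} : F ∉ corners D ↔ ∀ i, ¬ IsCornerFace D i F := by
  rw [mem_corners, not_exists]
  exact forall_congr' fun i => by rw [isCornerFace_iff_eq_yc]

/-- a corner face touches `G`. [cite: KhristoforovSmirnov2021, §1.2 (loop configurations, pp. 2–3)] -/
theorem yc_mem_touching (i : Fin nm) : yc D i ∈ triFacesTouching D.verts := cornerFace_mem_touching D (yc_spec D i)




end Literature.Probability.Percolation.MarkedLoops
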